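import Literature.Analysis.FluidPDE.ScalarFourierData
import Literature.Analysis.FluidPDE.TorusNSGevreyLattice
import Literature.Analysis.FunctionSpaces.TorusFourierModes
import Literature.Analysis.FunctionSpaces.TorusFourierCalculus
import Literature.Analysis.FunctionSpaces.TorusVectorParseval
import Literature.Analysis.FunctionSpaces.TorusFourierSeries
import Literature.Analysis.FunctionSpaces.TorusLerayHelmholtzProofs
import Literature.Analysis.FunctionSpaces.TorusSobolevNormFacts
import Literature.Analysis.FunctionSpaces.TorusSpaceTime
import HarnessLib

/-!
# Fourier coefficients of the slices of a classical Navier–Stokes solution on `T^d`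

Analysis/FluidPDE support file (theorems only), second of the files proving the Gevrey-class
smoothing estimate of Foias–Temam (J. Funct. Anal. 87 (1989), Thm 1.1) for classical solutions
of the Navier–Stokes system on `T^d` (`TorusNSGevreyLattice`, `TorusNSGevreyBalance`,
`TorusNSGevreyBootstrap`). It is the dictionary between the classical torus calculus of
`Torus.IsClassicalNSSolutionOn` and the lattice `ℤ^d` on which the estimate is run, for vector
slices `û(t, k) = 𝓕(complexify ∘ u t)(k) ∈ ℂ^d` and a general time set `S`:

* `hasDerivWithinAt_mFourierCoeff_complexify`, `hasDerivWithinAt_norm_sq_mFourierCoeff` —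
  `d/dt û(t,k) = 𝓕(∂ₜu(t))(k)` and `d/dt ‖û(t,k)‖² = 2 Re ⟪𝓕(∂ₜu(t))(k), û(t,k)⟫` within `S`
  (differentiation under the torus integral, `Torus.IsSmoothSpaceTimeOn.hasDerivWithinAt_integral`;
  the `univ` versions are in the summit file `…/Negative/FourierSlices.lean`);
* `norm_le_sum_norm_apply` and `norm_mFourierCoeff_convect_le` — **the convective term is a
  lattice convolution**: `‖𝓕((u·∇)v)(k)‖ ≤ 2π (card d)² ∑ₘ ‖û(m)‖ |k − m| ‖v̂(k − m)‖`
  (`ScalarFourier.mFourierCoeff_mul` componentwise, `𝓕(∂ⱼ g)(l) = 2πi lⱼ ĝ(l)`), with the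
  summability of the majorant;
* `re_inner_mFourierCoeff_gradient_eq_zero` — the pressure gradient is invisible in the energy
  of each mode of a divergence-free field: `Re ⟪𝓕(∇q)(k), û(k)⟫ = 0` (`û(k) ⊥ k`,
  `Torus.IsDivFree.sum_mul_mFourierCoeff_eq_zero`);
* `IsClassicalNSSolutionOn.re_inner_mFourierCoeff_timeDerivWithin` — the **modewise energy
  identity** `Re ⟪𝓕(∂ₜu)(k), û(k)⟫ = −4π²ν|k|² ‖û(k)‖² − Re ⟪𝓕((u·∇)u)(k), û(k)⟫ + Re ⟪f̂(k), û(k)⟫`.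

## Mathlib / tree search

Tree (reused): `ScalarFourier.mFourierCoeff_mul`, `ScalarFourier.lconv` (`ScalarFourierData`),
`Torus.mFourierCoeff_complexify_laplacian`, `mFourierCoeff_finset_sum` (`TorusFourierModes`),
`Torus.mFourierCoeff_complexify_gradient_apply_eq` (`TorusLerayHelmholtzProofs`),
`Torus.IsDivFree.sum_mul_mFourierCoeff_eq_zero` (`TorusTrigPoly`), `Torus.IsSmoothSpaceTimeOn.*`
(`TorusSpaceTime`, `TorusCalculusProofs`). The `Fin 3` dictionary
`SteadyLattice.mFourierCoeff_convect_real` (`SteadyNSLatticePersistence`) is the model for the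
general-`d` convective bound here.

References: C. Foias, R. Temam, J. Funct. Anal. 87 (1989) 359–369, §2 (the equation in Fourier
variables) [FoiasTemam1989]; L. Grafakos, *Classical Fourier Analysis*, 3rd ed. (2014),
Prop. 3.2.6 (8) [Grafakos2014].
-/

noncomputable section

open MeasureTheory Set Filter UnitAddTorus Function Finset
open scoped Topology BigOperators InnerProductSpace ComplexConjugate

namespace Literature.Analysis.FluidPDE

namespace NSGevrey

open Literature.Analysis.FunctionSpaces Literature.Analysis.FunctionSpaces.Torus
open ScalarFourier (lconv lconv_apply mFourierCoeff_mul)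

variable {d : Type*} [Fintype d] [DecidableEq d]

/-! ### Time derivatives of the slice coefficients within the time set -/

section TimeDeriv

variable {S : Set ℝ} {u : ℝ → UnitAddTorus d → EuclideanSpace ℝ d}

omit [DecidableEq d] in
/-- **Time derivative of the slice coefficients of a jointly smooth real field**, within a convex
time set of unique differentiability: `d/dt 𝓕(complexify ∘ u t)(k) = 𝓕(complexify ∘ ∂ₜu(t))(k)`
(differentiation under the torus integral). [folklore] -/
theorem hasDerivWithinAt_mFourierCoeff_complexify (hu : IsSmoothSpaceTimeOn S u) (hS : Convex ℝ S)
    (hS' : UniqueDiffOn ℝ S) {t : ℝ} (ht : t ∈ S) (k : d → ℤ) :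
    HasDerivWithinAt (fun s => mFourierCoeff (EuclideanSpace.complexify ∘ u s) k)
      (mFourierCoeff (EuclideanSpace.complexify ∘ timeDerivWithin S u t) k) S t := by
  set w : ℝ → UnitAddTorus d → EuclideanSpace ℂ d :=
    fun s x => (mFourier (-k) x : ℂ) • EuclideanSpace.complexify (u s x) with hw
  have hcu : IsSmoothSpaceTimeOn S (fun s x => EuclideanSpace.complexify (u s x)) :=
    hu.clm_comp EuclideanSpace.complexify.toContinuousLinearMap
  have he : IsSmoothSpaceTimeOn S (fun (_ : ℝ) (x : UnitAddTorus d) => (mFourier (-k) x : ℂ)) :=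
    isSmoothSpaceTimeOn_const (isSmooth_mFourier (-k)) S
  have hws : IsSmoothSpaceTimeOn S w := ContDiffOn.smul he hcu
  have hD := hws.hasDerivWithinAt_integral hS ht
  have hslice : ∀ x, timeDerivWithin S w t x =
      (mFourier (-k) x : ℂ) • EuclideanSpace.complexify (timeDerivWithin S u t x) := by
    intro x
    have h1 : HasDerivWithinAt (fun s => u s x) (timeDerivWithin S u t x) S t :=
      hu.hasDerivWithinAt_slice ht x
    have h2 : HasDerivWithinAt (fun s => EuclideanSpace.complexify (u s x))
        (EuclideanSpace.complexify (timeDerivWithin S u t x)) S t := by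
      have := (EuclideanSpace.complexify (ι := d)).toContinuousLinearMap.hasFDerivAt.comp_hasDerivWithinAt
        t h1
      simpa [Function.comp_def] using this
    exact (h2.const_smul (mFourier (-k) x : ℂ)).derivWithin (hS' t ht)
  have hint_eq : (∫ x, timeDerivWithin S w t x) =
      mFourierCoeff (EuclideanSpace.complexify ∘ timeDerivWithin S u t) k := by
    rw [mFourierCoeff_eq_integral_volume]
    exact integral_congr_ae (ae_of_all _ fun x => hslice x)
  have hfun : (fun s => ∫ x, w s x) = fun s => mFourierCoeff (EuclideanSpace.complexify ∘ u s) k := by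
    funext s
    rw [mFourierCoeff_eq_integral_volume]
    rfl
  rw [hfun, hint_eq] at hD
  exact hD

omit [DecidableEq d] in
/-- `d/dt ‖û(t,k)‖² = 2 Re ⟪𝓕(∂ₜu(t))(k), û(t,k)⟫_ℂ` within the time set. [folklore] -/
theorem hasDerivWithinAt_norm_sq_mFourierCoeff (hu : IsSmoothSpaceTimeOn S u) (hS : Convex ℝ S)
    (hS' : UniqueDiffOn ℝ S) {t : ℝ} (ht : t ∈ S) (k : d → ℤ) :
    HasDerivWithinAt (fun s => ‖mFourierCoeff (EuclideanSpace.complexify ∘ u s) k‖ ^ 2)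
      (2 * (inner ℂ (mFourierCoeff (EuclideanSpace.complexify ∘ timeDerivWithin S u t) k)
        (mFourierCoeff (EuclideanSpace.complexify ∘ u t) k)).re) S t := by
  have hf := hasDerivWithinAt_mFourierCoeff_complexify hu hS hS' ht k
  have h2 := Complex.reCLM.hasFDerivAt.comp_hasDerivWithinAt t (hf.inner ℂ hf)
  have hfun : (fun s => ‖mFourierCoeff (EuclideanSpace.complexify ∘ u s) k‖ ^ 2) =
      (⇑Complex.reCLM ∘ fun s => ⟪mFourierCoeff (EuclideanSpace.complexify ∘ u s) k,
        mFourierCoeff (EuclideanSpace.complexify ∘ u s) k⟫_ℂ) := by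
    funext s
    simp only [Function.comp_apply, Complex.reCLM_apply]
    rw [← inner_self_eq_norm_sq (𝕜 := ℂ), RCLike.re_to_complex]
  rw [hfun]
  refine h2.congr_deriv ?_
  rw [Complex.reCLM_apply, Complex.add_re,
    ← inner_conj_symm _ (mFourierCoeff (EuclideanSpace.complexify ∘ timeDerivWithin S u t) k),
    Complex.conj_re]
  ring

omit [DecidableEq d] in
/-- The slice coefficients of a jointly smooth field are continuous in time on the time set. [folklore] -/
theorem continuousOn_norm_sq_mFourierCoeff (hu : IsSmoothSpaceTimeOn S u) (hS : Convex ℝ S)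
    (hS' : UniqueDiffOn ℝ S) (k : d → ℤ) :
    ContinuousOn (fun s => ‖mFourierCoeff (EuclideanSpace.complexify ∘ u s) k‖ ^ 2) S :=
  fun _ ht => (hasDerivWithinAt_norm_sq_mFourierCoeff hu hS hS' ht k).continuousWithinAt

end TimeDeriv

/-! ### The convective term as a lattice convolution: a pointwise bound -/

section Convect

omit [DecidableEq d] in
/-- `‖w‖ ≤ ∑ᵢ ‖wᵢ‖` in `ℂ^d`. [folklore] -/
theorem norm_le_sum_norm_apply (w : EuclideanSpace ℂ d) : ‖w‖ ≤ ∑ i, ‖w i‖ := by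
  classical
  conv_lhs => rw [← EuclideanSpace.sum_apply_smul_single w]
  refine (norm_sum_le _ _).trans (le_of_eq (Finset.sum_congr rfl fun i _ => ?_))
  rw [norm_smul, PiLp.norm_single, norm_one, mul_one]

variable {u v : UnitAddTorus d → EuclideanSpace ℝ d}

/-- Complexification commutes with partial derivatives of a component. [folklore] -/
theorem partialDeriv_ofReal_apply (hv : IsSmooth v) (j p : d) (y : UnitAddTorus d) :
    Torus.partialDeriv j (fun z => ((v z p : ℝ) : ℂ)) y = ((Torus.partialDeriv j (fun z => v z p) y : ℝ) : ℂ) :=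
  partialDeriv_clm_comp (hv.apply p) Complex.ofRealCLM j y

/-- Components of partial derivatives of a real field. [folklore] -/
theorem partialDeriv_apply_real (hv : IsSmooth v) (j p : d) (y : UnitAddTorus d) :
    (Torus.partialDeriv j v y) p = Torus.partialDeriv j (fun z => v z p) y := by
  have h := partialDeriv_clm_comp hv (EuclideanSpace.proj p : EuclideanSpace ℝ d →L[ℝ] ℝ) j y
  have e : ((EuclideanSpace.proj p : EuclideanSpace ℝ d →L[ℝ] ℝ) ∘ v) = fun z => v z p := by
    funext z; simp
  rw [e] at h
  simpa using h.symm

/-- The coefficients of a complexified component of a smooth real field are the components of the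
vector coefficients, hence absolutely summable. [folklore] -/
theorem summable_norm_mFourierCoeff_ofReal_apply (hu : IsSmooth u) (j : d) :
    Summable fun m : d → ℤ => ‖mFourierCoeff (fun y => ((u y j : ℝ) : ℂ)) m‖ := by
  have h := (hu.complexify_comp.rapidDecay_mFourierCoeff).summable_norm
  refine Summable.of_nonneg_of_le (fun _ => norm_nonneg _) (fun m => ?_) h
  rw [← mFourierCoeff_complexify_apply hu.integrable m j]
  exact PiLp.norm_apply_le _ j

/-- For smooth `v` the family `l ↦ |l| ‖v̂(l)‖` is bounded (by `∑ₗ (1 + |l|²) ‖v̂(l)‖`). [folklore] -/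
theorem sqrt_freqNormSq_mul_norm_mFourierCoeff_le (hv : IsSmooth v) (l : d → ℤ) :
    Real.sqrt (freqNormSq l) * ‖mFourierCoeff (EuclideanSpace.complexify ∘ v) l‖ ≤
      ∑' m : d → ℤ, (1 + freqNormSq m) ^ 1 * ‖mFourierCoeff (EuclideanSpace.complexify ∘ v) m‖ := by
  have hs := hv.complexify_comp.rapidDecay_mFourierCoeff 1
  have hle : Real.sqrt (freqNormSq l) ≤ (1 + freqNormSq l) ^ 1 := by
    rw [pow_one]
    have h0 := freqNormSq_nonneg l
    rcases le_total (freqNormSq l) 1 with h | h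
    · calc Real.sqrt (freqNormSq l) ≤ Real.sqrt 1 := Real.sqrt_le_sqrt h
        _ = 1 := Real.sqrt_one
        _ ≤ 1 + freqNormSq l := by linarith
    · calc Real.sqrt (freqNormSq l) ≤ freqNormSq l := by
            rw [Real.sqrt_le_left (by linarith)]
            nlinarith
        _ ≤ 1 + freqNormSq l := by linarith
  calc Real.sqrt (freqNormSq l) * ‖mFourierCoeff (EuclideanSpace.complexify ∘ v) l‖
      ≤ (1 + freqNormSq l) ^ 1 * ‖mFourierCoeff (EuclideanSpace.complexify ∘ v) l‖ :=
        mul_le_mul_of_nonneg_right hle (norm_nonneg _)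
    _ ≤ ∑' m : d → ℤ, (1 + freqNormSq m) ^ 1 * ‖mFourierCoeff (EuclideanSpace.complexify ∘ v) m‖ :=
        hs.le_tsum l fun m _ => mul_nonneg (one_add_freqNormSq_pow_nonneg m 1) (norm_nonneg _)

/-- Summability of the convolution majorant `m ↦ ‖û(m)‖ |k − m| ‖v̂(k − m)‖` (smooth `u, v`). [folklore] -/
theorem summable_convectMajorant (hu : IsSmooth u) (hv : IsSmooth v) (k : d → ℤ) :
    Summable fun m : d → ℤ => ‖mFourierCoeff (EuclideanSpace.complexify ∘ u) m‖ *
      (Real.sqrt (freqNormSq (k - m)) * ‖mFourierCoeff (EuclideanSpace.complexify ∘ v) (k - m)‖) := by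
  have h := (hu.complexify_comp.rapidDecay_mFourierCoeff).summable_norm.mul_right
    (∑' m : d → ℤ, (1 + freqNormSq m) ^ 1 * ‖mFourierCoeff (EuclideanSpace.complexify ∘ v) m‖)
  refine h.of_nonneg_of_le (fun m => mul_nonneg (norm_nonneg _)
    (mul_nonneg (Real.sqrt_nonneg _) (norm_nonneg _))) fun m => ?_
  exact mul_le_mul_of_nonneg_left (sqrt_freqNormSq_mul_norm_mFourierCoeff_le hv (k - m))
    (norm_nonneg _)

/-- **The convective term is a lattice convolution — pointwise bound** (general `d`): for smooth
real fields `u, v` on `T^d` and every frequency `k`,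
`‖𝓕(complexify ∘ (u·∇)v)(k)‖ ≤ 2π (card d)² ∑ₘ ‖û(m)‖ |k − m| ‖v̂(k − m)‖`
(componentwise `𝓕((u·∇)v)ₚ(k) = ∑ⱼ ∑ₘ ûⱼ(m) (2πi (k−m)ⱼ) v̂ₚ(k−m)`: products are convolutions of
coefficients, `ScalarFourier.mFourierCoeff_mul`, and `𝓕(∂ⱼ g)(l) = 2πi lⱼ ĝ(l)`; cf. the `Fin 3`
identity `SteadyLattice.mFourierCoeff_convect_real`). [cite: FoiasTemam1989, §2 (2.6)] -/
theorem norm_mFourierCoeff_convect_le (hu : IsSmooth u) (hv : IsSmooth v) (k : d → ℤ) :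
    ‖mFourierCoeff (EuclideanSpace.complexify ∘ Torus.convect u v) k‖ ≤
      2 * Real.pi * (Fintype.card d : ℝ) ^ 2 * ∑' m : d → ℤ,
        ‖mFourierCoeff (EuclideanSpace.complexify ∘ u) m‖ *
          (Real.sqrt (freqNormSq (k - m)) * ‖mFourierCoeff (EuclideanSpace.complexify ∘ v) (k - m)‖) := by
  set U : (d → ℤ) → EuclideanSpace ℂ d := fun m => mFourierCoeff (EuclideanSpace.complexify ∘ u) m with hU
  set V : (d → ℤ) → EuclideanSpace ℂ d := fun m => mFourierCoeff (EuclideanSpace.complexify ∘ v) m with hV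
  set T : ℝ := ∑' m : d → ℤ, ‖U m‖ * (Real.sqrt (freqNormSq (k - m)) * ‖V (k - m)‖) with hT
  have hTs : Summable fun m : d → ℤ => ‖U m‖ * (Real.sqrt (freqNormSq (k - m)) * ‖V (k - m)‖) :=
    summable_convectMajorant hu hv k
  have hT0 : 0 ≤ T := tsum_nonneg fun m => mul_nonneg (norm_nonneg _)
    (mul_nonneg (Real.sqrt_nonneg _) (norm_nonneg _))
  have hcs : IsSmooth (Torus.convect u v) := hu.convect hv
  -- smooth complexified components
  have huj : ∀ j, IsSmooth (fun z => ((u z j : ℝ) : ℂ)) := fun j => (hu.apply j).comp_clm Complex.ofRealCLM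
  have hvp : ∀ p, IsSmooth (fun z => ((v z p : ℝ) : ℂ)) := fun p => (hv.apply p).comp_clm Complex.ofRealCLM
  -- the components of the convective term
  have hfun : ∀ p, (fun y => (EuclideanSpace.complexify ∘ Torus.convect u v) y p) =
      fun y => ∑ j, (fun z => ((u z j : ℝ) : ℂ)) y * Torus.partialDeriv j (fun z => ((v z p : ℝ) : ℂ)) y := by
    intro p
    funext y
    simp only [Function.comp_apply, EuclideanSpace.complexify_apply]
    rw [Torus.convect, fderiv_apply_eq_sum_partialDeriv (hv.isContDiff (by simp)) y (u y)]
    simp only [WithLp.ofLp_sum, WithLp.ofLp_smul, Finset.sum_apply, Pi.smul_apply, smul_eq_mul]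
    push_cast
    refine Finset.sum_congr rfl fun j _ => ?_
    rw [partialDeriv_ofReal_apply hv j p y, partialDeriv_apply_real hv j p y]
  -- componentwise identity `𝓕((u·∇)v)ₚ(k) = ∑ⱼ ∑ₘ Uⱼ(m) (2πi(k-m)ⱼ V(k-m)ₚ)`
  have hcomp : ∀ p, mFourierCoeff (EuclideanSpace.complexify ∘ Torus.convect u v) k p =
      ∑ j, ∑' m, U m j * ((2 * Real.pi * Complex.I * ((k - m) j : ℤ)) * V (k - m) p) := by
    intro p
    rw [mFourierCoeff_apply_euclidean hcs.complexify_comp.integrable, hfun p,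
      mFourierCoeff_finset_sum
        (f := fun j y => (fun z => ((u z j : ℝ) : ℂ)) y * Torus.partialDeriv j (fun z => ((v z p : ℝ) : ℂ)) y)
        _ fun j _ => ((huj j).continuous.mul ((hvp p).partialDeriv j).continuous).integrable_unitAddTorus]
    refine Finset.sum_congr rfl fun j _ => ?_
    rw [mFourierCoeff_mul (huj j).continuous (summable_norm_mFourierCoeff_ofReal_apply hu j)
      ((hvp p).partialDeriv j).continuous, lconv_apply]
    refine tsum_congr fun m => ?_
    rw [← mFourierCoeff_complexify_apply hu.integrable m j, mFourierCoeff_partialDeriv (hvp p) j (k - m),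
      ← mFourierCoeff_complexify_apply hv.integrable (k - m) p, smul_eq_mul]
  -- the bound, componentwise
  have hterm : ∀ p j m, ‖U m j * ((2 * Real.pi * Complex.I * ((k - m) j : ℤ)) * V (k - m) p)‖ ≤
      2 * Real.pi * (‖U m‖ * (Real.sqrt (freqNormSq (k - m)) * ‖V (k - m)‖)) := by
    intro p j m
    rw [norm_mul, norm_mul]
    have h1 : ‖U m j‖ ≤ ‖U m‖ := PiLp.norm_apply_le _ j
    have h2 : ‖V (k - m) p‖ ≤ ‖V (k - m)‖ := PiLp.norm_apply_le _ p
    have h3 : ‖(2 * Real.pi * Complex.I * ((k - m) j : ℤ) : ℂ)‖ ≤ 2 * Real.pi * Real.sqrt (freqNormSq (k - m)) := by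
      rw [norm_mul, Complex.norm_intCast]
      have : ‖(2 * Real.pi * Complex.I : ℂ)‖ = 2 * Real.pi := by
        simp [abs_of_pos Real.pi_pos]
      rw [this]
      exact mul_le_mul_of_nonneg_left (abs_apply_le_sqrt_freqNormSq (k - m) j) (by positivity)
    calc ‖U m j‖ * (‖(2 * Real.pi * Complex.I * ((k - m) j : ℤ) : ℂ)‖ * ‖V (k - m) p‖)
        ≤ ‖U m‖ * ((2 * Real.pi * Real.sqrt (freqNormSq (k - m))) * ‖V (k - m)‖) :=
          mul_le_mul h1 (mul_le_mul h3 h2 (norm_nonneg _) (by positivity)) (by positivity) (norm_nonneg _)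
      _ = 2 * Real.pi * (‖U m‖ * (Real.sqrt (freqNormSq (k - m)) * ‖V (k - m)‖)) := by ring
  have hp : ∀ p, ‖mFourierCoeff (EuclideanSpace.complexify ∘ Torus.convect u v) k p‖ ≤
      (Fintype.card d : ℝ) * (2 * Real.pi * T) := by
    intro p
    rw [hcomp p]
    refine (norm_sum_le _ _).trans ?_
    calc ∑ j, ‖∑' m, U m j * ((2 * Real.pi * Complex.I * ((k - m) j : ℤ)) * V (k - m) p)‖
        ≤ ∑ _j : d, 2 * Real.pi * T := Finset.sum_le_sum fun j _ => by
          have hs : Summable fun m => 2 * Real.pi * (‖U m‖ * (Real.sqrt (freqNormSq (k - m)) * ‖V (k - m)‖)) :=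
            hTs.mul_left _
          have hs' : Summable fun m => ‖U m j * ((2 * Real.pi * Complex.I * ((k - m) j : ℤ)) * V (k - m) p)‖ :=
            hs.of_nonneg_of_le (fun _ => norm_nonneg _) (hterm p j)
          calc ‖∑' m, U m j * ((2 * Real.pi * Complex.I * ((k - m) j : ℤ)) * V (k - m) p)‖
              ≤ ∑' m, ‖U m j * ((2 * Real.pi * Complex.I * ((k - m) j : ℤ)) * V (k - m) p)‖ :=
                norm_tsum_le_tsum_norm hs'
            _ ≤ ∑' m, 2 * Real.pi * (‖U m‖ * (Real.sqrt (freqNormSq (k - m)) * ‖V (k - m)‖)) :=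
                hs'.tsum_le_tsum (hterm p j) hs
            _ = 2 * Real.pi * T := by rw [tsum_mul_left]
      _ = (Fintype.card d : ℝ) * (2 * Real.pi * T) := by
          rw [Finset.sum_const, Finset.card_univ, nsmul_eq_mul]
  calc ‖mFourierCoeff (EuclideanSpace.complexify ∘ Torus.convect u v) k‖
      ≤ ∑ p, ‖mFourierCoeff (EuclideanSpace.complexify ∘ Torus.convect u v) k p‖ := norm_le_sum_norm_apply _
    _ ≤ ∑ _p : d, (Fintype.card d : ℝ) * (2 * Real.pi * T) := Finset.sum_le_sum fun p _ => hp p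
    _ = 2 * Real.pi * (Fintype.card d : ℝ) ^ 2 * T := by
        rw [Finset.sum_const, Finset.card_univ, nsmul_eq_mul]
        ring

end Convect

/-! ### The pressure is invisible modewise; the modewise energy identity -/

section Energy

/-- **The pressure gradient is orthogonal to every mode of a divergence-free field**:
`⟪𝓕(complexify ∘ ∇q)(k), û(k)⟫_ℂ = 0` for smooth `q` and smooth divergence-free `u`
(`𝓕(∇q)(k) = 2πi q̂(k) k` and `k · û(k) = 0`, `Torus.IsDivFree.sum_mul_mFourierCoeff_eq_zero`;
Robinson–Rodrigo–Sadowski 2016, §2.1: "`u` is divergence free iff `û_k ⊥ k`"). [folklore] -/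
theorem inner_mFourierCoeff_gradient_eq_zero {q : UnitAddTorus d → ℝ} (hq : IsSmooth q)
    {u : UnitAddTorus d → EuclideanSpace ℝ d} (hu : IsSmooth u) (hdiv : IsDivFree u) (k : d → ℤ) :
    inner ℂ (mFourierCoeff (EuclideanSpace.complexify ∘ Torus.gradient q) k)
      (mFourierCoeff (EuclideanSpace.complexify ∘ u) k) = 0 := by
  have h0 := hdiv.sum_mul_mFourierCoeff_eq_zero hu k
  rw [PiLp.inner_apply]
  simp only [mFourierCoeff_complexify_gradient_apply_eq hq, RCLike.inner_apply, map_mul, Complex.conj_I,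
    Complex.conj_ofReal, map_ofNat, map_intCast]
  have : ∑ i, (k i : ℂ) * mFourierCoeff (EuclideanSpace.complexify ∘ u) k i *
      (2 * (Real.pi : ℂ) * -Complex.I * (starRingEnd ℂ) (mFourierCoeff (fun x => (q x : ℂ)) k)) = 0 := by
    rw [← Finset.sum_mul, h0, zero_mul]
  rw [← this]
  refine Finset.sum_congr rfl fun i _ => ?_
  ring

variable {S : Set ℝ} {ν : ℝ} {f u : ℝ → UnitAddTorus d → EuclideanSpace ℝ d}
  {p : ℝ → UnitAddTorus d → ℝ}

/-- **The momentum equation in Fourier variables, paired with the mode** (Foias–Temam 1989, §2;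
Robinson–Rodrigo–Sadowski 2016, (2.11)): for a classical solution on `S × T^d` (`S` of unique
differentiability) and `t ∈ S`,
`Re ⟪𝓕(∂ₜu(t))(k), û(t,k)⟫ = −4π²ν|k|² ‖û(t,k)‖² − Re ⟪𝓕((u·∇)u)(k), û(t,k)⟫ + Re ⟪f̂(t,k), û(t,k)⟫`
(`𝓕(Δu)(k) = −4π²|k|² û(k)`, and the pressure term vanishes by
`inner_mFourierCoeff_gradient_eq_zero`). [cite: FoiasTemam1989, §2 (2.4)–(2.6)] -/
theorem _root_.Literature.Analysis.FunctionSpaces.Torus.IsClassicalNSSolutionOn.re_inner_mFourierCoeff_timeDerivWithin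
    (h : IsClassicalNSSolutionOn S ν f u p) (hU : UniqueDiffOn ℝ S) {t : ℝ} (ht : t ∈ S) (k : d → ℤ) :
    (inner ℂ (mFourierCoeff (EuclideanSpace.complexify ∘ timeDerivWithin S u t) k)
        (mFourierCoeff (EuclideanSpace.complexify ∘ u t) k)).re =
      -(ν * (4 * Real.pi ^ 2 * freqNormSq k)) * ‖mFourierCoeff (EuclideanSpace.complexify ∘ u t) k‖ ^ 2 -
        (inner ℂ (mFourierCoeff (EuclideanSpace.complexify ∘ Torus.convect (u t) (u t)) k)
          (mFourierCoeff (EuclideanSpace.complexify ∘ u t) k)).re +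
        (inner ℂ (mFourierCoeff (EuclideanSpace.complexify ∘ f t) k)
          (mFourierCoeff (EuclideanSpace.complexify ∘ u t) k)).re := by
  have hut : IsSmooth (u t) := h.smooth_velocity.isSmooth_slice ht
  have hpt : IsSmooth (p t) := h.smooth_pressure.isSmooth_slice ht
  have hdt : IsSmooth (timeDerivWithin S u t) := h.smooth_velocity.isSmooth_timeDerivWithin hU ht
  have hct : IsSmooth (Torus.convect (u t) (u t)) := hut.convect hut
  -- the force slice is smooth, being `∂ₜu + (u·∇)u − νΔu + ∇p`
  have hpoint : ∀ x, timeDerivWithin S u t x = ν • Torus.laplacian (u t) x -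
      Torus.convect (u t) (u t) x - Torus.gradient (p t) x + f t x := by
    intro x
    rw [eq_sub_of_add_eq (h.momentum t ht x)]
    abel
  have hfeq : f t = (timeDerivWithin S u t + Torus.convect (u t) (u t) + Torus.gradient (p t)) -
      ν • Torus.laplacian (u t) := by
    funext x
    simp only [Pi.add_apply, Pi.sub_apply, Pi.smul_apply, hpoint x]
    abel
  have hft : IsSmooth (f t) := by
    rw [hfeq]
    exact ((hdt.add hct).add hpt.gradient).sub (hut.laplacian.smul ν)
  -- the equation for the complexified slices
  have heq : (EuclideanSpace.complexify ∘ timeDerivWithin S u t) =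
      ((ν : ℂ) • (EuclideanSpace.complexify ∘ Torus.laplacian (u t)) -
        EuclideanSpace.complexify ∘ Torus.convect (u t) (u t) -
        EuclideanSpace.complexify ∘ Torus.gradient (p t)) + EuclideanSpace.complexify ∘ f t := by
    funext x
    simp only [Pi.add_apply, Pi.sub_apply, Pi.smul_apply, Function.comp_apply, hpoint x, map_sub, map_add,
      LinearIsometry.map_smul, Complex.coe_smul]
  have hi1 : Integrable (EuclideanSpace.complexify ∘ Torus.laplacian (u t)) volume :=
    integrable_complexify_comp hut.laplacian.integrable
  have hi2 : Integrable (EuclideanSpace.complexify ∘ Torus.convect (u t) (u t)) volume :=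
    integrable_complexify_comp hct.integrable
  have hi3 : Integrable (EuclideanSpace.complexify ∘ Torus.gradient (p t)) volume :=
    integrable_complexify_comp hpt.gradient.integrable
  have hi4 : Integrable (EuclideanSpace.complexify ∘ f t) volume := integrable_complexify_comp hft.integrable
  rw [heq]
  rw [mFourierCoeff_add ((((hi1.smul (ν : ℂ)).sub hi2).sub hi3)) hi4,
    mFourierCoeff_sub ((hi1.smul (ν : ℂ)).sub hi2) hi3, mFourierCoeff_sub (hi1.smul (ν : ℂ)) hi2,
    mFourierCoeff_const_smul, mFourierCoeff_complexify_laplacian hut]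
  simp only [inner_add_left, inner_sub_left, inner_smul_left, inner_neg_left, Complex.conj_ofReal,
    inner_mFourierCoeff_gradient_eq_zero hpt hut (h.divFree t ht), sub_zero, Complex.add_re,
    Complex.sub_re]
  set w : EuclideanSpace ℂ d := mFourierCoeff (EuclideanSpace.complexify ∘ u t) k with hw
  have hself : (inner ℂ w w).re = ‖w‖ ^ 2 := by
    have := inner_self_eq_norm_sq (𝕜 := ℂ) w
    rwa [RCLike.re_to_complex] at this
  have hre : ((ν : ℂ) * -(((4 * Real.pi ^ 2 * freqNormSq k : ℝ) : ℂ) * inner ℂ w w)).re =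
      -(ν * (4 * Real.pi ^ 2 * freqNormSq k)) * ‖w‖ ^ 2 := by
    rw [← hself, show (ν : ℂ) * -(((4 * Real.pi ^ 2 * freqNormSq k : ℝ) : ℂ) * inner ℂ w w) =
      ((-(ν * (4 * Real.pi ^ 2 * freqNormSq k)) : ℝ) : ℂ) * inner ℂ w w by push_cast; ring,
      Complex.re_ofReal_mul]
  rw [hre]

end Energy


end NSGevrey

end Literature.Analysis.FluidPDE
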